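import Summits.QuantumFields.QCD.Theorems.EulerDescentHonestHeavyAnchorSplit
import Literature.MathematicalPhysics.QuantumFieldTheory.QCDAsymptoticScalingCouplingDivergence

/-!
# `HonestHeavyAnchor` (crux stmt-QuantumFields-16901, route `EulerDescent`) — negative side, CORNER clause:
# what any witness is committed to on the Wilson mass axis, the three kill scenarios, and the exact content of
# the line's corner stub S2 (`stub_intrinsicCorner` ⟺ the FIXED-COUPLING corner law)

cdisprove seat `refuter-cdisprove-stmt-QuantumFields-16901-0`, cycle 1 (2026-08-17); work file
`Cruxes/HonestHeavyAnchor/Disproof.lean` §2 and §5.  No `def`: every statement is written out over `QCDOS.lean`.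

* `exists_reg_of_tendsto_beta` — EVERY divergent coupling sequence `β_k → +∞` is realised EXACTLY
  (`β_k = afBeta N_f 1 a_k` for all large `k`, `a_k → 0⁺`, `a_k L_k → ∞`, `Z_m(k) = (log a_k⁻²)^{γ₀/(2β₀)}`) by a
  mass-scaling, two-loop-scaling `QCDRegularisation N_f` (`N_f = 2, 3`; intermediate value theorem on the continuous,
  divergent profile).  Consequence: the packaging "`∀ reg, (reg.scheme 0 0 0).HasAsymptoticScaling →`" of the line's
  stubs S2–S4 (skeleton sha ef6d2c2b…, `Lines/bounded_locator.lean`) quantifies over all divergent coupling sequences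
  and nothing else.
* `stub_intrinsicCorner_iff_seq_cornerLaw`, `seq_cornerLaw_iff_fixedCoupling`,
  `stub_intrinsicCorner_iff_fixedCouplingCornerLaw` — the registered stub S2 (verbatim) is EQUIVALENT to the
  sequence-free, regularisation-free statement: for `N_f ∈ {2,3}` there is `β₀` such that for every `β ≥ β₀` the set
  of non-massive degenerate bare Wilson masses at coupling `β` has a least upper bound, and
  `β ↦ sSup (non-massive set at β)` tends to `0` at `+∞` (`κ_c(β) → 1/8`).  S2 is thus a theorem about the
  Wilson-fermion lattice phase diagram at fixed coupling alone: its `BddAbove` half is clustering of lattice QCD with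
  arbitrarily heavy degenerate quarks at fixed weak coupling (lattice Yang–Mills hard), its `Nonempty` half is the
  existence of a transition on the Wilson axis at fixed weak coupling for the `(−1)^F`-twisted odd-torus functional.
* `honestHeavyAnchor_corner_commitments` — any witness of the crux runs along `β_k → +∞`, its pin is a LATTICE-unit
  pin (`m_crit(k) − mc(k) → 0`, since `a_k/Z_m(k) → 0`), and therefore (pin + branch `m_crit > −1`) at every large `β_k`
  there is a NON-MASSIVE degenerate bare mass above `−1 − ε`, while everything above `mc k` is massive.
* `honestHeavyAnchor_false_of_allMassive` / `_of_masslessPhase` / `_of_deepCorner` — the ONLY three corner-side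
  kill scenarios, each a statement about the fixed-coupling phase diagram (no transition at weak coupling; no bound on
  the non-massive set at weak coupling — the Patrascioiu–Seiler-type massless phase; only doubler transitions at or
  below `−1 − ε`).  Each is believed FALSE (SharpeSingleton1998 / Aoki1984WilsonPhase give non-massive points near
  `m' = 0` in both scenarios; `κ_c → 1/8`), so they are recorded as plain implications, not filed `--negative-modulo`:
  a disproof of the crux through its corner clause must PROVE one of them at cofinally many couplings of every
  two-loop sequence — each harder than S2 itself.  (The body side, `ThresholdQCD` = stmt-8794, is attacked nowhere here.)
-/

namespace Summit.QuantumFields.QCD.Theorems.HonestHeavyAnchor.Negative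

open Filter Topology
open Literature.MathematicalPhysics.QuantumFieldTheory
open Summit.QuantumFields.QCD.Theses
open Summit.QuantumFields.QCD.Theorems.HonestHeavyAnchorSplit (massExponent_nonneg tendsto_a_div_Zm)

variable {Nf : ℕ}

/-! ## Realising every divergent coupling sequence by a two-loop, mass-scaling regularisation -/

/-- The two-loop profile `a ↦ afBeta N_f 1 a` is continuous on `(0, 1)`. [folklore] -/
theorem continuousOn_afBeta_one (Nf : ℕ) : ContinuousOn (fun a : ℝ => afBeta Nf 1 a) (Set.Ioo 0 1) := by
  have hq : ∀ a ∈ Set.Ioo (0 : ℝ) 1, 1 < 1 / (a ^ 2 * (1 : ℝ) ^ 2) := by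
    intro a ha
    have ha2 : a ^ 2 < 1 := by nlinarith [ha.1, ha.2]
    rw [one_pow, mul_one, lt_div_iff₀ (pow_pos ha.1 2), one_mul]
    exact ha2
  have h1 : ContinuousOn (fun a : ℝ => 1 / (a ^ 2 * (1 : ℝ) ^ 2)) (Set.Ioo 0 1) := by
    refine continuousOn_const.div (by fun_prop) fun a ha => ?_
    exact (mul_pos (pow_pos ha.1 2) (by norm_num)).ne'
  have h2 : ContinuousOn (fun a : ℝ => Real.log (1 / (a ^ 2 * (1 : ℝ) ^ 2))) (Set.Ioo 0 1) :=
    h1.log fun a ha => (zero_lt_one.trans (hq a ha)).ne'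
  have h3 : ContinuousOn (fun a : ℝ => Real.log (Real.log (1 / (a ^ 2 * (1 : ℝ) ^ 2)))) (Set.Ioo 0 1) :=
    h2.log fun a ha => (Real.log_pos (hq a ha)).ne'
  unfold afBeta
  exact (continuousOn_const.mul h2).add (continuousOn_const.mul h3)

/-- **Every large inverse coupling is attained by the two-loop profile at a spacing in `(0, 1/2]`** (`N_f ≤ 16`):
divergence of the profile along `a_k = 1/(k+1)` (`tendsto_afBeta_atTop`) plus the intermediate value theorem.
[folklore] -/
theorem exists_afBeta_one_eq (hNf16 : Nf ≤ 16) :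
    ∃ B₀ : ℝ, ∀ b : ℝ, B₀ ≤ b → ∃ a : ℝ, 0 < a ∧ a ≤ 1 / 2 ∧ afBeta Nf 1 a = b := by
  refine ⟨afBeta Nf 1 (1 / 2), fun b hb => ?_⟩
  have hseq : Tendsto (fun k : ℕ => afBeta Nf 1 (1 / ((k : ℝ) + 1))) atTop atTop :=
    tendsto_afBeta_atTop hNf16 one_pos (a := fun k : ℕ => 1 / ((k : ℝ) + 1)) (fun k => by positivity)
      tendsto_one_div_add_atTop_nhds_zero_nat
  obtain ⟨k, hk, hk1⟩ := ((hseq.eventually_ge_atTop b).and (eventually_ge_atTop 1)).exists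
  set a₁ : ℝ := 1 / ((k : ℝ) + 1) with ha₁
  have hk1' : (1 : ℝ) ≤ k := by exact_mod_cast hk1
  have ha₁pos : 0 < a₁ := by rw [ha₁]; positivity
  have ha₁le : a₁ ≤ 1 / 2 := by
    rw [ha₁, div_le_div_iff₀ (by positivity) (by norm_num)]
    linarith
  have hcont : ContinuousOn (fun a : ℝ => afBeta Nf 1 a) (Set.Icc a₁ (1 / 2)) :=
    (continuousOn_afBeta_one Nf).mono fun x hx => ⟨ha₁pos.trans_le hx.1, hx.2.trans_lt (by norm_num)⟩
  have hmem : b ∈ Set.Icc (afBeta Nf 1 (1 / 2)) (afBeta Nf 1 a₁) := ⟨hb, hk⟩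
  obtain ⟨a, ⟨ha1, ha2⟩, hfa⟩ := intermediate_value_Icc' ha₁le hcont hmem
  exact ⟨a, ha₁pos.trans_le ha1, ha2, hfa⟩

/-- **Every divergent coupling sequence is realised EXACTLY by a mass-scaling, two-loop-scaling regularisation**
(`N_f = 2, 3`): for `β_k → +∞` there is `reg : QCDRegularisation N_f` with `reg.β = β`,
`(reg.scheme 0 0 0).HasAsymptoticScaling` (indeed `β_k = afBeta N_f 1 a_k` for all large `k`, `a_k → 0⁺`,
`a_k L_k → ∞`) and `reg.HasMassScaling` (`Z_m(k) = (log a_k⁻²)^{γ₀/(2β₀)}`, `c = 1`). [folklore] -/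
theorem exists_reg_of_tendsto_beta (hNf : Nf = 2 ∨ Nf = 3) (β : ℕ → ℝ) (hβ : Tendsto β atTop atTop) :
    ∃ reg : QCDRegularisation Nf, reg.β = β ∧ (reg.scheme 0 0 0).HasAsymptoticScaling ∧ reg.HasMassScaling := by
  classical
  have h16 : Nf ≤ 16 := by rcases hNf with rfl | rfl <;> norm_num
  obtain ⟨B₀, hsol⟩ := exists_afBeta_one_eq (Nf := Nf) h16
  -- the spacing realising the coupling `b` (junk `1/2` below `B₀`)
  let sel : ℝ → ℝ := fun b => if h : B₀ ≤ b then Classical.choose (hsol b h) else 1 / 2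
  have hsel_pos : ∀ b, 0 < sel b := by
    intro b
    by_cases h : B₀ ≤ b
    · simp only [sel, dif_pos h]
      exact (Classical.choose_spec (hsol b h)).1
    · simp only [sel, dif_neg h]
      norm_num
  have hsel_le : ∀ b, sel b ≤ 1 / 2 := by
    intro b
    by_cases h : B₀ ≤ b
    · simp only [sel, dif_pos h]
      exact (Classical.choose_spec (hsol b h)).2.1
    · simp only [sel, dif_neg h]
      norm_num
  have hsel_eq : ∀ b, B₀ ≤ b → afBeta Nf 1 (sel b) = b := by
    intro b h
    simp only [sel, dif_pos h]
    exact (Classical.choose_spec (hsol b h)).2.2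
  let a : ℕ → ℝ := fun k => sel (β k)
  have ha_pos : ∀ k, 0 < a k := fun k => hsel_pos _
  have ha_le : ∀ k, a k ≤ 1 / 2 := fun k => hsel_le _
  have ha_eq : ∀ k, B₀ ≤ β k → afBeta Nf 1 (a k) = β k := fun k hk => hsel_eq _ hk
  -- `a_k → 0`: the profile is bounded on `[ε, 1/2]`, while `afBeta (a_k) = β_k → ∞`
  have ha0 : Tendsto a atTop (𝓝 0) := by
    rw [tendsto_order]
    refine ⟨fun a' ha' => Eventually.of_forall fun k => ha'.trans (ha_pos k), fun ε hε => ?_⟩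
    obtain ⟨K, hK⟩ : ∃ K : ℝ, ∀ x ∈ Set.Icc ε (1 / 2), afBeta Nf 1 x ≤ K := by
      have hc : ContinuousOn (fun x : ℝ => afBeta Nf 1 x) (Set.Icc ε (1 / 2)) :=
        (continuousOn_afBeta_one Nf).mono fun x hx => ⟨hε.trans_le hx.1, hx.2.trans_lt (by norm_num)⟩
      obtain ⟨K, hK⟩ := isCompact_Icc.bddAbove_image hc
      exact ⟨K, fun x hx => hK ⟨x, hx, rfl⟩⟩
    filter_upwards [hβ.eventually_ge_atTop (max B₀ (K + 1))] with k hk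
    have hB : B₀ ≤ β k := le_trans (le_max_left _ _) hk
    have hKk : K + 1 ≤ β k := le_trans (le_max_right _ _) hk
    by_contra hnot
    have hmem : a k ∈ Set.Icc ε (1 / 2) := ⟨not_lt.1 hnot, ha_le k⟩
    have hle := hK (a k) hmem
    rw [ha_eq k hB] at hle
    linarith
  -- volumes `L_k = ⌈a_k⁻²⌉`, so `a_k L_k ≥ 1/a_k → ∞`
  have hinv : Tendsto (fun k => 1 / a k) atTop atTop := by
    have h' : Tendsto a atTop (𝓝[>] 0) := tendsto_nhdsWithin_iff.2 ⟨ha0, Eventually.of_forall ha_pos⟩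
    simpa [one_div, Function.comp_def] using tendsto_inv_nhdsGT_zero.comp h'
  have hL : Tendsto (fun k => a k * ((⌈1 / a k ^ 2⌉₊ : ℕ) : ℝ)) atTop atTop := by
    refine tendsto_atTop_mono (fun k => ?_) hinv
    have hak := ha_pos k
    have hak' : a k ≠ 0 := hak.ne'
    calc 1 / a k = a k * (1 / a k ^ 2) := by field_simp
      _ ≤ a k * ((⌈1 / a k ^ 2⌉₊ : ℕ) : ℝ) := mul_le_mul_of_nonneg_left (Nat.le_ceil _) hak.le
  -- `Z_m(k) = (log a_k⁻²)^γ > 0`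
  have hgt : ∀ k, 1 < 1 / a k ^ 2 := fun k => by
    have h1 : a k ^ 2 < 1 := by nlinarith [ha_pos k, ha_le k]
    rw [lt_div_iff₀ (pow_pos (ha_pos k) 2), one_mul]
    exact h1
  have hZpos : ∀ k, 0 < Real.log (1 / a k ^ 2) ^ massExponent Nf := fun k =>
    Real.rpow_pos_of_pos (Real.log_pos (hgt k)) _
  let reg : QCDRegularisation Nf :=
    { a := a, a_pos := ha_pos, tendsto_a := ha0, β := β, L := fun k => ⌈1 / a k ^ 2⌉₊, tendsto_L := hL,
      mcrit := fun _ => 0, Zm := fun k => Real.log (1 / a k ^ 2) ^ massExponent Nf, Zm_pos := hZpos }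
  refine ⟨reg, rfl, ⟨1, one_pos, ?_⟩, ⟨1, one_pos, ?_⟩⟩
  · refine tendsto_const_nhds.congr' ?_
    filter_upwards [hβ.eventually_ge_atTop B₀] with k hk
    show (0 : ℝ) = β k - afBeta Nf 1 (a k)
    rw [ha_eq k hk, sub_self]
  · refine tendsto_const_nhds.congr' (Eventually.of_forall fun k => ?_)
    show (1 : ℝ) = Real.log (1 / a k ^ 2) ^ massExponent Nf / Real.log (1 / a k ^ 2) ^ massExponent Nf
    rw [div_self (hZpos k).ne']

/-! ## The corner stub S2 of line `bounded_locator` is the fixed-coupling corner law -/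

/-- **S2 ⟺ the corner law along every divergent coupling sequence** (`N_f = 2, 3`).  Left: the registered stub
`stub_intrinsicCorner` VERBATIM (skeleton sha ef6d2c2b…).  The regularisation and its two-loop hypothesis are inert
packaging: (⇒) realise `β` by `exists_reg_of_tendsto_beta`; (⇐) `β_k → +∞` along any two-loop sequence
(`QCDScheme.tendsto_beta_atTop_of_hasAsymptoticScaling`). [folklore] -/
theorem stub_intrinsicCorner_iff_seq_cornerLaw :
    (∀ Nf : ℕ, Nf = 2 ∨ Nf = 3 → ∀ reg : QCDRegularisation Nf, (reg.scheme 0 0 0).HasAsymptoticScaling →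
      ∃ mc : ℕ → ℝ, (∀ᶠ k in atTop, IsLUB {μ : ℝ | ¬ (∀ (R R' : ℕ) (A : QCDLatticeObservable Nf R) (B : QCDLatticeObservable Nf R'),
        ∃ (C δ : ℝ) (S₀ : ℕ), 0 < δ ∧ ∀ S : ℕ, S₀ ≤ S → ∀ n : ℕ, n ≤ S →
          ‖qcdLatticeConnectedCorr (reg.β k) (2 * S + 1) (fun _ : Fin Nf => μ) A B n‖ ≤ C * Real.exp (-(δ * n)))} (mc k)) ∧
        Tendsto mc atTop (𝓝 0)) ↔
    ∀ Nf : ℕ, Nf = 2 ∨ Nf = 3 → ∀ β : ℕ → ℝ, Tendsto β atTop atTop →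
      ∃ mc : ℕ → ℝ, (∀ᶠ k in atTop, IsLUB {μ : ℝ | ¬ (∀ (R R' : ℕ) (A : QCDLatticeObservable Nf R) (B : QCDLatticeObservable Nf R'),
        ∃ (C δ : ℝ) (S₀ : ℕ), 0 < δ ∧ ∀ S : ℕ, S₀ ≤ S → ∀ n : ℕ, n ≤ S →
          ‖qcdLatticeConnectedCorr (β k) (2 * S + 1) (fun _ : Fin Nf => μ) A B n‖ ≤ C * Real.exp (-(δ * n)))} (mc k)) ∧
        Tendsto mc atTop (𝓝 0) := by
  constructor
  · intro h Nf hNf β hβ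
    obtain ⟨reg, hreg, haf, -⟩ := exists_reg_of_tendsto_beta hNf β hβ
    obtain ⟨mc, hc, hmc⟩ := h Nf hNf reg haf
    subst hreg
    exact ⟨mc, hc, hmc⟩
  · intro h Nf hNf reg haf
    have h16 : Nf ≤ 16 := by rcases hNf with rfl | rfl <;> norm_num
    obtain ⟨mc, hc, hmc⟩ := h Nf hNf reg.β
      (QCDScheme.tendsto_beta_atTop_of_hasAsymptoticScaling h16 (reg.scheme 0 0 0) haf)
    exact ⟨mc, hc, hmc⟩

/-- **Sequences ⟺ function** (pure order theory/topology, any family of sets `N : ℝ → Set ℝ`): "along every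
`β_k → +∞`, eventually `N (β_k)` has a least upper bound `mc k`, and `mc k → 0`" is equivalent to "for all large `β`,
`N β` has a least upper bound, and `β ↦ sSup (N β)` tends to `0` at `+∞`" (`atTop` on `ℝ` is countably generated;
an `IsLUB` value is `sSup`). [folklore] -/
theorem seq_cornerLaw_iff_fixedCoupling (N : ℝ → Set ℝ) :
    (∀ β : ℕ → ℝ, Tendsto β atTop atTop →
      ∃ mc : ℕ → ℝ, (∀ᶠ k in atTop, IsLUB (N (β k)) (mc k)) ∧ Tendsto mc atTop (𝓝 0)) ↔
    ((∃ β₀ : ℝ, ∀ β : ℝ, β₀ ≤ β → ∃ m : ℝ, IsLUB (N β) m) ∧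
      Tendsto (fun β : ℝ => sSup (N β)) atTop (𝓝 0)) := by
  constructor
  · intro h
    refine ⟨?_, ?_⟩
    · by_contra hno
      simp only [not_exists, not_forall, exists_prop] at hno
      choose g hg hno' using hno
      have hβ : Tendsto (fun k : ℕ => g k) atTop atTop :=
        tendsto_atTop_mono (fun k => hg k) tendsto_natCast_atTop_atTop
      obtain ⟨mc, hc, -⟩ := h _ hβ
      obtain ⟨k, hk⟩ := hc.exists
      exact hno' _ _ hk
    · rw [tendsto_iff_seq_tendsto]
      intro β hβ
      obtain ⟨mc, hc, hmc⟩ := h β hβ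
      refine hmc.congr' ?_
      filter_upwards [hc] with k hk
      exact (hk.csSup_eq hk.nonempty).symm
  · rintro ⟨⟨β₀, hβ₀⟩, hlim⟩ β hβ
    refine ⟨fun k => sSup (N (β k)), ?_, hlim.comp hβ⟩
    filter_upwards [hβ.eventually_ge_atTop β₀] with k hk
    obtain ⟨m, hm⟩ := hβ₀ _ hk
    exact isLUB_csSup hm.nonempty hm.bddAbove

/-- **S2 ⟺ the FIXED-COUPLING corner law**: the registered stub `stub_intrinsicCorner` (verbatim, left) holds iff for
`N_f ∈ {2,3}` there is `β₀` such that for every `β ≥ β₀` the set of NON-MASSIVE degenerate bare Wilson masses at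
coupling `β` (some pair of gauge-invariant local observables fails to cluster at any lattice rate uniformly in the odd
torus) has a least upper bound, and `β ↦ sSup` of that set tends to `0` as `β → +∞`.  No sequence, no regularisation:
S2 is a statement about the Wilson-fermion lattice phase diagram at fixed coupling. [folklore] -/
theorem stub_intrinsicCorner_iff_fixedCouplingCornerLaw :
    (∀ Nf : ℕ, Nf = 2 ∨ Nf = 3 → ∀ reg : QCDRegularisation Nf, (reg.scheme 0 0 0).HasAsymptoticScaling →
      ∃ mc : ℕ → ℝ, (∀ᶠ k in atTop, IsLUB {μ : ℝ | ¬ (∀ (R R' : ℕ) (A : QCDLatticeObservable Nf R) (B : QCDLatticeObservable Nf R'),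
        ∃ (C δ : ℝ) (S₀ : ℕ), 0 < δ ∧ ∀ S : ℕ, S₀ ≤ S → ∀ n : ℕ, n ≤ S →
          ‖qcdLatticeConnectedCorr (reg.β k) (2 * S + 1) (fun _ : Fin Nf => μ) A B n‖ ≤ C * Real.exp (-(δ * n)))} (mc k)) ∧
        Tendsto mc atTop (𝓝 0)) ↔
    ∀ Nf : ℕ, Nf = 2 ∨ Nf = 3 →
      (∃ β₀ : ℝ, ∀ β : ℝ, β₀ ≤ β → ∃ m : ℝ, IsLUB {μ : ℝ | ¬ (∀ (R R' : ℕ) (A : QCDLatticeObservable Nf R) (B : QCDLatticeObservable Nf R'),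
        ∃ (C δ : ℝ) (S₀ : ℕ), 0 < δ ∧ ∀ S : ℕ, S₀ ≤ S → ∀ n : ℕ, n ≤ S →
          ‖qcdLatticeConnectedCorr (β) (2 * S + 1) (fun _ : Fin Nf => μ) A B n‖ ≤ C * Real.exp (-(δ * n)))} m) ∧
      Tendsto (fun β : ℝ => sSup {μ : ℝ | ¬ (∀ (R R' : ℕ) (A : QCDLatticeObservable Nf R) (B : QCDLatticeObservable Nf R'),
        ∃ (C δ : ℝ) (S₀ : ℕ), 0 < δ ∧ ∀ S : ℕ, S₀ ≤ S → ∀ n : ℕ, n ≤ S →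
          ‖qcdLatticeConnectedCorr (β) (2 * S + 1) (fun _ : Fin Nf => μ) A B n‖ ≤ C * Real.exp (-(δ * n)))}) atTop (𝓝 0) := by
  rw [stub_intrinsicCorner_iff_seq_cornerLaw]
  refine forall₂_congr fun Nf _ => ?_
  exact seq_cornerLaw_iff_fixedCoupling (fun β : ℝ => {μ : ℝ | ¬ (∀ (R R' : ℕ) (A : QCDLatticeObservable Nf R) (B : QCDLatticeObservable Nf R'),
        ∃ (C δ : ℝ) (S₀ : ℕ), 0 < δ ∧ ∀ S : ℕ, S₀ ≤ S → ∀ n : ℕ, n ≤ S →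
          ‖qcdLatticeConnectedCorr (β) (2 * S + 1) (fun _ : Fin Nf => μ) A B n‖ ≤ C * Real.exp (-(δ * n)))})

/-! ## What any witness of the crux is committed to on the Wilson axis, and the three corner-side kill scenarios -/

/-- **Corner-side commitments of any witness of `HonestHeavyAnchor`** (`N_f = 2, 3`): its couplings diverge
(`β_k → +∞`); eventually `mc k` is the least upper bound of the non-massive set at `β_k` (so the set is non-empty,
bounded above, and every degenerate bare mass above `mc k` is massive); the pin is a LATTICE-unit pin,
`m_crit(k) − mc(k) → 0` (`= offset · a_k/Z_m(k)`, both factors `→ 0`); hence, with the branch `m_crit(k) > −1`, for every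
`ε > 0` at every large `β_k` there is a NON-MASSIVE degenerate bare mass above `−1 − ε` — a transition of the Wilson
axis above the doubler zone, for the `(−1)^F`-twisted odd-torus functional `qcdTorusExpect`. [folklore] -/
theorem honestHeavyAnchor_corner_commitments (h : EulerDescent.HonestHeavyAnchor) (hNf : Nf = 2 ∨ Nf = 3) :
    ∃ (reg : QCDRegularisation Nf) (mc : ℕ → ℝ), Tendsto reg.β atTop atTop ∧
      (∀ᶠ k in atTop, IsLUB {μ : ℝ | ¬ (∀ (R R' : ℕ) (A : QCDLatticeObservable Nf R) (B : QCDLatticeObservable Nf R'),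
        ∃ (C δ : ℝ) (S₀ : ℕ), 0 < δ ∧ ∀ S : ℕ, S₀ ≤ S → ∀ n : ℕ, n ≤ S →
          ‖qcdLatticeConnectedCorr (reg.β k) (2 * S + 1) (fun _ : Fin Nf => μ) A B n‖ ≤ C * Real.exp (-(δ * n)))} (mc k)) ∧
      Tendsto (fun k => reg.mcrit k - mc k) atTop (𝓝 0) ∧
      (∀ ε : ℝ, 0 < ε → ∀ᶠ k in atTop, ∃ μ ∈ {μ : ℝ | ¬ (∀ (R R' : ℕ) (A : QCDLatticeObservable Nf R) (B : QCDLatticeObservable Nf R'),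
        ∃ (C δ : ℝ) (S₀ : ℕ), 0 < δ ∧ ∀ S : ℕ, S₀ ≤ S → ∀ n : ℕ, n ≤ S →
          ‖qcdLatticeConnectedCorr (reg.β k) (2 * S + 1) (fun _ : Fin Nf => μ) A B n‖ ≤ C * Real.exp (-(δ * n)))}, -1 - ε < μ) ∧
      ∀ᶠ k in atTop, ∀ μ : ℝ, mc k < μ → μ ∉ {μ : ℝ | ¬ (∀ (R R' : ℕ) (A : QCDLatticeObservable Nf R) (B : QCDLatticeObservable Nf R'),
        ∃ (C δ : ℝ) (S₀ : ℕ), 0 < δ ∧ ∀ S : ℕ, S₀ ≤ S → ∀ n : ℕ, n ≤ S →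
          ‖qcdLatticeConnectedCorr (reg.β k) (2 * S + 1) (fun _ : Fin Nf => μ) A B n‖ ≤ C * Real.exp (-(δ * n)))} := by
  have h16 : Nf ≤ 16 := by rcases hNf with rfl | rfl <;> norm_num
  obtain ⟨reg, mc, Mh, hcorner, hpin, hms, haf, hbranch, -, -⟩ := h Nf hNf
  have hβ : Tendsto reg.β atTop atTop :=
    QCDScheme.tendsto_beta_atTop_of_hasAsymptoticScaling h16 (reg.scheme 0 0 0) haf
  have hsub : Tendsto (fun k => reg.mcrit k - mc k) atTop (𝓝 0) := by
    have h1 := hpin.mul (tendsto_a_div_Zm reg hms (massExponent_nonneg hNf))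
    rw [mul_zero] at h1
    refine h1.congr fun k => ?_
    have ha : reg.a k ≠ 0 := (reg.a_pos k).ne'
    have hZ : reg.Zm k ≠ 0 := (reg.Zm_pos k).ne'
    field_simp
  refine ⟨reg, mc, hβ, hcorner, hsub, fun ε hε => ?_, ?_⟩
  · filter_upwards [hcorner, hsub.eventually_lt_const hε, hbranch] with k hk hlt hb
    by_contra hno
    simp only [not_exists, not_and, not_lt] at hno
    have hub : mc k ≤ -1 - ε := hk.2 fun μ hμ => hno μ hμ
    linarith
  · filter_upwards [hcorner] with k hk
    exact fun μ hμ hmem => (not_lt.2 (hk.1 hmem)) hμ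

/-- KILL SCENARIO 1 refutes the crux: **no transition on the Wilson axis at weak coupling** (for all large `β` every
degenerate bare mass is massive) — against `IsLUB ∅`.  Believed false (SharpeSingleton1998: Aoki edge or first-order
coexistence near `m' = 0`). [folklore] -/
theorem honestHeavyAnchor_false_of_allMassive (hNf : Nf = 2 ∨ Nf = 3)
    (H : ∃ β₀ : ℝ, ∀ β : ℝ, β₀ ≤ β → {μ : ℝ | ¬ (∀ (R R' : ℕ) (A : QCDLatticeObservable Nf R) (B : QCDLatticeObservable Nf R'),
        ∃ (C δ : ℝ) (S₀ : ℕ), 0 < δ ∧ ∀ S : ℕ, S₀ ≤ S → ∀ n : ℕ, n ≤ S →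
          ‖qcdLatticeConnectedCorr (β) (2 * S + 1) (fun _ : Fin Nf => μ) A B n‖ ≤ C * Real.exp (-(δ * n)))} = ∅) :
    ¬ EulerDescent.HonestHeavyAnchor := by
  intro h
  obtain ⟨reg, mc, hβ, hcorner, -, -, -⟩ := honestHeavyAnchor_corner_commitments h hNf
  obtain ⟨β₀, hβ₀⟩ := H
  obtain ⟨k, hk, hk'⟩ := (hcorner.and (hβ.eventually_ge_atTop β₀)).exists
  have hne := hk.nonempty
  rw [hβ₀ _ hk'] at hne
  exact Set.not_nonempty_empty hne

/-- KILL SCENARIO 2 refutes the crux: **no bound on the non-massive set at weak coupling** (arbitrarily heavy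
degenerate quarks fail to cluster — the Patrascioiu–Seiler-type massless weak-coupling phase, its only printed
proponent) — against `IsLUB ⇒ BddAbove`.  Believed false. [folklore] -/
theorem honestHeavyAnchor_false_of_masslessPhase (hNf : Nf = 2 ∨ Nf = 3)
    (H : ∃ β₀ : ℝ, ∀ β : ℝ, β₀ ≤ β → ¬ BddAbove {μ : ℝ | ¬ (∀ (R R' : ℕ) (A : QCDLatticeObservable Nf R) (B : QCDLatticeObservable Nf R'),
        ∃ (C δ : ℝ) (S₀ : ℕ), 0 < δ ∧ ∀ S : ℕ, S₀ ≤ S → ∀ n : ℕ, n ≤ S →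
          ‖qcdLatticeConnectedCorr (β) (2 * S + 1) (fun _ : Fin Nf => μ) A B n‖ ≤ C * Real.exp (-(δ * n)))}) :
    ¬ EulerDescent.HonestHeavyAnchor := by
  intro h
  obtain ⟨reg, mc, hβ, hcorner, -, -, -⟩ := honestHeavyAnchor_corner_commitments h hNf
  obtain ⟨β₀, hβ₀⟩ := H
  obtain ⟨k, hk, hk'⟩ := (hcorner.and (hβ.eventually_ge_atTop β₀)).exists
  exact hβ₀ _ hk' hk.bddAbove

/-- KILL SCENARIO 3 refutes the crux: **only deep transitions at weak coupling** (every non-massive degenerate bare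
mass lies at or below `−1 − ε`: doublers only) — against the commitment "non-massive point above `−1 − ε`" (pin +
branch).  Believed false (`κ_c(β) → 1/8`, i.e. `m_c(β) → 0⁻`). [folklore] -/
theorem honestHeavyAnchor_false_of_deepCorner (hNf : Nf = 2 ∨ Nf = 3)
    (H : ∃ β₀ ε : ℝ, 0 < ε ∧ ∀ β : ℝ, β₀ ≤ β → ∀ μ ∈ {μ : ℝ | ¬ (∀ (R R' : ℕ) (A : QCDLatticeObservable Nf R) (B : QCDLatticeObservable Nf R'),
        ∃ (C δ : ℝ) (S₀ : ℕ), 0 < δ ∧ ∀ S : ℕ, S₀ ≤ S → ∀ n : ℕ, n ≤ S →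
          ‖qcdLatticeConnectedCorr (β) (2 * S + 1) (fun _ : Fin Nf => μ) A B n‖ ≤ C * Real.exp (-(δ * n)))}, μ ≤ -1 - ε) :
    ¬ EulerDescent.HonestHeavyAnchor := by
  intro h
  obtain ⟨reg, mc, hβ, -, -, hne, -⟩ := honestHeavyAnchor_corner_commitments h hNf
  obtain ⟨β₀, ε, hε, hβ₀⟩ := H
  obtain ⟨k, ⟨μ, hμ, hgt⟩, hk'⟩ := ((hne ε hε).and (hβ.eventually_ge_atTop β₀)).exists
  have := hβ₀ _ hk' μ hμ
  linarith

end Summit.QuantumFields.QCD.Theorems.HonestHeavyAnchor.Negative
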